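import Mathlib.Algebra.Polynomial.Taylor
import Mathlib.Algebra.Polynomial.Derivative
import Mathlib.Algebra.MvPolynomial.CommRing
import HarnessLib

/-!
# The formal integral of a polynomial flow: `exp(T𝔇)` as a one-parameter group (instrument for the `W(f)` toy model — NOT a resolution theorem)

Engine 1 of the RESOLUTION OBSERVATORY toy model `W(f)` (weighted-centre invariant in characteristic `p`; cell notes
RE-DERIVATION-eng1-g42 §3.3 (c) "THE EXPONENTIAL SOLUTION", CARVER-NOTES-eng1-g42 §3 (iii)(c), theorem T99a) needs the
following piece of formal calculus.  Let `A(y)` be a polynomial, `C` a direction (a vector of polynomials constant along the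
flow), `F(w) := A(y + wC) = Σ_b w^b Δ_C^{(b)} A` its Taylor polynomial, `d ≥ deg F` with `(d+1)!` invertible.  Put
`E(T; y) := Σ_{M=1}^{d+1} T^M Δ_C^{(M-1)} A / M` ("`= ∫_0^T A(y + wC) dw`").  Then
`E(T₁; y) + E(T₂; y + T₁C) = E(T₁ + T₂; y)` — so `y ↦ y + TC, x ↦ x + E_x(T; y)` is a ONE-PARAMETER GROUP of substitutions
("`exp(T𝔇)`"), which is what makes the power laws `Ỹ(T)^n = Ỹ(nT)` of loc. cit. automatic.

Contents (all ours, bookkeeping over [Lang2002, Ch. IV §1]; univariate part over any commutative ring `S`, the "inverses of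
`1, …, d+1`" being DATA `ω : ℕ → S` with `ω b * (b+1) = 1` for `b ≤ deg F`, so that no field / characteristic hypothesis
appears):
* `antideriv ω F := Σ_{b ≤ deg F} C (F_b ω_b) X^{b+1}` — the formal integral `∫_0^X F`; `coeff_antideriv_succ`
  (`[X^{M}] ∫F = F_{M-1} ω_{M-1}`, i.e. `A^{exp}_M = Δ^{(M-1)} A / M`), `coeff_antideriv_zero`, `natDegree_antideriv_le`,
  `derivative_antideriv` (`(∫F)' = F`), `eq_of_derivative_eq` (uniqueness of a primitive with given constant term when
  `1, …, N` are invertible);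
* `antideriv_taylor` — `∫_0^X F(t + w) dw = (∫F)(X + t) - (∫F)(t)`, i.e. `antideriv ω (taylor t F) = taylor t (antideriv ω F)
  - C ((antideriv ω F).eval t)`; `eval_add_antideriv` — THE GROUP LAW `(∫F)(t + u) = (∫F)(t) + (∫_0^u F(t + w) dw)`;
* `sum_eval_natCast_mul` — the power sums behind `Y^n(x) = x + Σ_b S_b(n) T^b Δ^{(b)}_C A_x` (loc. cit. §3.3):
  `Σ_{i<n} F(i t) = Σ_b S_b(n) F_b t^b`, `S_b(n) = Σ_{i<n} i^b`;
* the DICTIONARY to shifts of the generic point along a polynomial direction field `v` (the substitution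
  `Ψ_v : X_j ↦ X_j + w·v_j`, written here as the raw `MvPolynomial.aeval`; it is `PolyShift.polyShift v` of
  `WeightedCentrePolyShift` by `rfl`, and `InvariantDirection.lineShift` for constant `v`): when `v` is constant along its
  own flow (`Ψ_v (v j) = C (v j)`, e.g. `v` supported on `Y`-slots with values in the `Z`-variables):
  `shift_eval_shift` (for `t` not moved, `Ψ_v t = C t`: `Ψ_v (A(X + t v)) = taylor t (Ψ_v A)`, "`A((y + tC) + wC) =
  A(y + (t+w)C)`"), `map_shift_eq_taylor` (coefficientwise, any `t`: `(Ψ_v A).map σ_t = taylor t (Ψ_v A)` for the shift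
  `σ_t := ev_t ∘ Ψ_v`), and the engine-facing group law `eval_add_antideriv_shift` (any `t`, `u`):
  `E(t + u; y) = E(t; y) + E(u; y + tC)` with `E := antideriv ω (Ψ_v A)` and "`E(u; y + tC)`" `:= (E.map σ_t).eval u`.

VALUE: bookkeeping for a toy model (Resolution Observatory cell `pub-rosobs`, carver lane gen 62; AI-written Lean, and AI
review is weaker than expert review); NOT a statement about the invariant of [AbramovichTemkinWlodarczyk2024], NOT progress
on the summit.
-/

namespace Literature.AlgebraicGeometry.Resolution.WeightedBlowup

namespace FormalIntegral

section Univariate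

open Polynomial Finset

variable {S : Type*} [CommRing S]

/-- (ours, bookkeeping) The formal integral `∫_0^X F = Σ_{b ≤ deg F} F_b ω_b X^{b+1}`, where `ω_b` plays `1/(b+1)`.
[cite: Lang2002, Ch. IV §1] -/
noncomputable def antideriv (ω : ℕ → S) (F : S[X]) : S[X] :=
  ∑ b ∈ range (F.natDegree + 1), C (F.coeff b * ω b) * X ^ (b + 1)

/-- (ours, bookkeeping) `[X^{b+1}] ∫F = F_b ω_b` ("`A^{exp}_{M} = Δ^{(M-1)} A / M`"). [cite: Lang2002, Ch. IV §1] -/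
theorem coeff_antideriv_succ (ω : ℕ → S) (F : S[X]) (b : ℕ) :
    (antideriv ω F).coeff (b + 1) = F.coeff b * ω b := by
  unfold antideriv
  rw [finsetSum_coeff]
  simp_rw [coeff_C_mul_X_pow]
  rw [Finset.sum_eq_single b]
  · rw [if_pos rfl]
  · intro b' _ hb'
    rw [if_neg]
    omega
  · intro hb
    rw [Finset.mem_range, not_lt] at hb
    rw [if_pos rfl, coeff_eq_zero_of_natDegree_lt (by omega), zero_mul]

/-- (ours, bookkeeping) `∫_0^X F` has no constant term. [cite: Lang2002, Ch. IV §1] -/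
theorem coeff_antideriv_zero (ω : ℕ → S) (F : S[X]) : (antideriv ω F).coeff 0 = 0 := by
  unfold antideriv
  rw [finsetSum_coeff]
  refine Finset.sum_eq_zero fun b _ => ?_
  rw [coeff_C_mul_X_pow, if_neg]
  omega

/-- (ours, bookkeeping) `(∫_0^X F)(0) = 0`. [cite: Lang2002, Ch. IV §1] -/
theorem eval_zero_antideriv (ω : ℕ → S) (F : S[X]) : (antideriv ω F).eval 0 = 0 := by
  rw [← coeff_zero_eq_eval_zero, coeff_antideriv_zero]

/-- (ours, bookkeeping) `deg ∫F ≤ deg F + 1`. [cite: Lang2002, Ch. IV §1] -/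
theorem natDegree_antideriv_le (ω : ℕ → S) (F : S[X]) : (antideriv ω F).natDegree ≤ F.natDegree + 1 := by
  unfold antideriv
  refine natDegree_sum_le_of_forall_le _ _ fun b hb => ?_
  refine natDegree_C_mul_X_pow_le _ _ |>.trans ?_
  rw [Finset.mem_range] at hb
  omega

/-- (ours, bookkeeping) `(∫F)' = F` as soon as `ω_b (b+1) = 1` for `b ≤ deg F`. [cite: Lang2002, Ch. IV §1] -/
theorem derivative_antideriv {ω : ℕ → S} {F : S[X]} (hω : ∀ b ≤ F.natDegree, ω b * (b + 1 : S) = 1) :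
    derivative (antideriv ω F) = F := by
  ext n
  rw [coeff_derivative, coeff_antideriv_succ]
  by_cases hn : n ≤ F.natDegree
  · rw [mul_assoc, hω n hn, mul_one]
  · rw [coeff_eq_zero_of_natDegree_lt (not_le.mp hn), zero_mul, zero_mul]

/-- (ours, bookkeeping) Uniqueness of primitives: two polynomials of degree `≤ N` with the same constant term and the same
derivative agree, provided `1, …, N` are invertible (witnessed by `ω`). [cite: Lang2002, Ch. IV §1] -/
theorem eq_of_derivative_eq {ω : ℕ → S} {N : ℕ} (hω : ∀ b < N, ω b * (b + 1 : S) = 1) {P Q : S[X]}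
    (hP : P.natDegree ≤ N) (hQ : Q.natDegree ≤ N) (h0 : P.coeff 0 = Q.coeff 0)
    (hd : derivative P = derivative Q) : P = Q := by
  ext n
  cases n with
  | zero => exact h0
  | succ n =>
    by_cases hn : n < N
    · have h := congrArg (fun R : S[X] => R.coeff n) hd
      simp only [coeff_derivative] at h
      have e : ((n : S) + 1) * ω n = 1 := by
        rw [mul_comm]
        exact hω n hn
      calc P.coeff (n + 1) = P.coeff (n + 1) * (((n : S) + 1) * ω n) := by rw [e, mul_one]
        _ = P.coeff (n + 1) * ((n : S) + 1) * ω n := by rw [mul_assoc]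
        _ = Q.coeff (n + 1) * ((n : S) + 1) * ω n := by rw [h]
        _ = Q.coeff (n + 1) := by rw [mul_assoc, e, mul_one]
    · rw [not_lt] at hn
      rw [coeff_eq_zero_of_natDegree_lt (by omega), coeff_eq_zero_of_natDegree_lt (by omega)]

/-- (ours, bookkeeping) **Translation of the formal integral**: `∫_0^X F(t + w) dw = (∫F)(X + t) - (∫F)(t)`.
[cite: Lang2002, Ch. IV §1] -/
theorem antideriv_taylor {ω : ℕ → S} {F : S[X]} (hω : ∀ b ≤ F.natDegree, ω b * (b + 1 : S) = 1) (t : S) :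
    antideriv ω (taylor t F) = taylor t (antideriv ω F) - C ((antideriv ω F).eval t) := by
  have hω' : ∀ b ≤ (taylor t F).natDegree, ω b * (b + 1 : S) = 1 := by
    intro b hb
    rw [natDegree_taylor] at hb
    exact hω b hb
  refine eq_of_derivative_eq (N := F.natDegree + 1) (fun b hb => hω b (by omega)) ?_ ?_ ?_ ?_
  · exact (natDegree_antideriv_le ω _).trans (by rw [natDegree_taylor])
  · refine (natDegree_sub_le _ _).trans (max_le ?_ ?_)
    · rw [natDegree_taylor]
      exact natDegree_antideriv_le ω F
    · rw [natDegree_C]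
      exact Nat.zero_le _
  · rw [coeff_antideriv_zero, coeff_sub, taylor_coeff_zero, coeff_C_zero, sub_self]
  · rw [derivative_antideriv hω', derivative_sub, derivative_C, sub_zero]
    simp only [taylor_apply]
    rw [derivative_comp, derivative_X_add_C, one_mul, derivative_antideriv hω]

/-- (ours, bookkeeping) **The one-parameter group law**: `(∫F)(t + u) = (∫F)(t) + ∫_0^u F(t + w) dw`, i.e.
`E(T₁ + T₂) = E(T₁) + E_{shifted by T₁}(T₂)`. [cite: Lang2002, Ch. IV §1] -/
theorem eval_add_antideriv {ω : ℕ → S} {F : S[X]} (hω : ∀ b ≤ F.natDegree, ω b * (b + 1 : S) = 1) (t u : S) :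
    (antideriv ω F).eval (t + u) = (antideriv ω F).eval t + (antideriv ω (taylor t F)).eval u := by
  rw [antideriv_taylor hω, eval_sub, eval_C, taylor_eval, add_comm t u]
  ring

/-- (ours, bookkeeping) Power sums: `Σ_{i<n} F(i·t) = Σ_b S_b(n) · F_b t^b` with `S_b(n) = Σ_{i<n} i^b` — the
coefficients of `Y^n(x) = x + Σ_{i<n} A_x(y + i T C)`. [cite: Lang2002, Ch. IV §1] -/
theorem sum_eval_natCast_mul (F : S[X]) (t : S) (n : ℕ) :
    ∑ i ∈ range n, F.eval ((i : S) * t)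
      = ∑ b ∈ range (F.natDegree + 1), (∑ i ∈ range n, (i : S) ^ b) * (F.coeff b * t ^ b) := by
  simp_rw [eval_eq_sum_range, mul_pow, Finset.sum_mul]
  rw [Finset.sum_comm]
  refine Finset.sum_congr rfl fun b _ => Finset.sum_congr rfl fun i _ => ?_
  ring

/-- (ours, bookkeeping) The formal integral written over a larger range (terms beyond `deg F` vanish).
[cite: Lang2002, Ch. IV §1] -/
theorem antideriv_eq_sum_of_le (ω : ℕ → S) {F : S[X]} {N : ℕ} (hN : F.natDegree ≤ N) :
    antideriv ω F = ∑ b ∈ range (N + 1), C (F.coeff b * ω b) * X ^ (b + 1) := by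
  unfold antideriv
  refine Finset.sum_subset (fun b hb => ?_) fun b _ hb => ?_
  · rw [Finset.mem_range] at hb ⊢
    omega
  · rw [Finset.mem_range, not_lt] at hb
    rw [coeff_eq_zero_of_natDegree_lt (by omega), zero_mul, C_0, zero_mul]

/-- (ours, bookkeeping) The formal integral commutes with a change of coefficients fixing the `ω_b`, as long as the
degree does not drop. [cite: Lang2002, Ch. IV §1] -/
theorem map_antideriv {S' : Type*} [CommRing S'] (σ : S →+* S') (ω : ℕ → S) (ω' : ℕ → S') (hω : ∀ b, σ (ω b) = ω' b)
    {F : S[X]} (hdeg : (F.map σ).natDegree = F.natDegree) :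
    (antideriv ω F).map σ = antideriv ω' (F.map σ) := by
  unfold antideriv
  rw [Polynomial.map_sum, hdeg]
  refine Finset.sum_congr rfl fun b _ => ?_
  rw [Polynomial.map_mul, Polynomial.map_pow, map_C, map_X, map_mul, hω, coeff_map]

end Univariate

section Shift

open MvPolynomial

variable {K : Type*} [CommRing K] {ι : Type*}

/-- The shift of the generic point along the polynomial direction field `v`: `X_j ↦ X_j + w·v_j` (local notation only; this is
`PolyShift.polyShift v` of `WeightedCentrePolyShift` by `rfl`). -/
local notation "Ψ[" v "]" =>
  (MvPolynomial.aeval fun j => Polynomial.C (MvPolynomial.X j) + Polynomial.X * Polynomial.C (v j) :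
    MvPolynomial ι K →ₐ[K] Polynomial (MvPolynomial ι K))

/-- (ours, bookkeeping) Plumbing: `Ψ_v (X j) = X_j + w v_j`. [cite: Lang2002, Ch. IV §1] -/
theorem shift_X (v : ι → MvPolynomial ι K) (j : ι) :
    Ψ[v] (X j) = Polynomial.C (X j) + Polynomial.X * Polynomial.C (v j) := by
  rw [MvPolynomial.aeval_X]

/-- (ours, bookkeeping) Plumbing: `Ψ_v (C a) = C (C a)`. [cite: Lang2002, Ch. IV §1] -/
theorem shift_C (v : ι → MvPolynomial ι K) (a : K) : Ψ[v] (C a) = Polynomial.C (C a) := by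
  rw [MvPolynomial.aeval_C, Polynomial.algebraMap_apply, MvPolynomial.algebraMap_eq]

/-- (ours, bookkeeping) The shift by `t·v` acting on coefficients: `σ_t := ev_t ∘ Ψ_v`, `σ_t (X j) = X_j + t v_j`.
[cite: Lang2002, Ch. IV §1] -/
theorem shiftEval_X (v : ι → MvPolynomial ι K) (t : MvPolynomial ι K) (j : ι) :
    ((Polynomial.evalRingHom t).comp (Ψ[v] : MvPolynomial ι K →ₐ[K] _).toRingHom) (X j) = X j + t * v j := by
  simp only [RingHom.coe_comp, AlgHom.toRingHom_eq_coe, RingHom.coe_coe, Function.comp_apply, shift_X,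
    Polynomial.coe_evalRingHom, Polynomial.eval_add, Polynomial.eval_C, Polynomial.eval_mul, Polynomial.eval_X]

/-- (ours, bookkeeping) A constant is fixed by every shift `σ_t`. [cite: Lang2002, Ch. IV §1] -/
theorem shiftEval_C (v : ι → MvPolynomial ι K) (t : MvPolynomial ι K) (c : K) :
    ((Polynomial.evalRingHom t).comp (Ψ[v] : MvPolynomial ι K →ₐ[K] _).toRingHom) (C c) = C c := by
  simp only [RingHom.coe_comp, AlgHom.toRingHom_eq_coe, RingHom.coe_coe, Function.comp_apply, shift_C,
    Polynomial.coe_evalRingHom, Polynomial.eval_C]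

/-- (ours, bookkeeping) **Flow property, substitution form**: if the direction field `v` is constant along its own flow and
`t` is not moved, then shifting `A(X + t v)` once more gives the Taylor translate: `Ψ_v (A(X + t v)) = (Ψ_v A)(w + t)`
("`A((y + tC) + wC) = A(y + (t + w)C)`"). [cite: Lang2002, Ch. IV §1] -/
theorem shift_eval_shift (v : ι → MvPolynomial ι K) (hv : ∀ j, Ψ[v] (v j) = Polynomial.C (v j))
    {t : MvPolynomial ι K} (ht : Ψ[v] t = Polynomial.C t) (A : MvPolynomial ι K) :
    Ψ[v] ((Ψ[v] A).eval t) = Polynomial.taylor t (Ψ[v] A) := by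
  have key : (Ψ[v] : MvPolynomial ι K →ₐ[K] _).toRingHom.comp
        ((Polynomial.evalRingHom t).comp (Ψ[v] : MvPolynomial ι K →ₐ[K] _).toRingHom)
      = (Polynomial.compRingHom (Polynomial.X + Polynomial.C t)).comp
        (Ψ[v] : MvPolynomial ι K →ₐ[K] _).toRingHom := by
    refine MvPolynomial.ringHom_ext (fun a => ?_) (fun j => ?_)
    · simp only [RingHom.coe_comp, AlgHom.toRingHom_eq_coe, RingHom.coe_coe, Function.comp_apply,
        Polynomial.coe_evalRingHom, Polynomial.coe_compRingHom_apply, shift_C, Polynomial.eval_C, Polynomial.C_comp]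
    · simp only [RingHom.coe_comp, AlgHom.toRingHom_eq_coe, RingHom.coe_coe, Function.comp_apply,
        Polynomial.coe_evalRingHom, Polynomial.coe_compRingHom_apply, shift_X, Polynomial.eval_add, Polynomial.eval_C,
        Polynomial.eval_mul, Polynomial.eval_X, map_add, map_mul, hv, ht, Polynomial.C_comp, Polynomial.X_comp]
      ring
  have h := congrArg (fun φ : MvPolynomial ι K →+* Polynomial (MvPolynomial ι K) => φ A) key
  simpa only [RingHom.coe_comp, AlgHom.toRingHom_eq_coe, RingHom.coe_coe, Function.comp_apply,
    Polynomial.coe_evalRingHom, Polynomial.coe_compRingHom_apply, Polynomial.taylor_apply] using h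

/-- (ours, bookkeeping) **Flow property, coefficientwise form**: with `σ_t := ev_t ∘ Ψ_v` the shift by `t·v` acting on
coefficients, `(Ψ_v A).map σ_t = (Ψ_v A)(w + t)` ("the Hasse coefficients of `A` at `y + tC` are those of the translate";
here `t` is arbitrary — a polynomial identity specialised). [cite: Lang2002, Ch. IV §1] -/
theorem map_shift_eq_taylor (v : ι → MvPolynomial ι K) (hv : ∀ j, Ψ[v] (v j) = Polynomial.C (v j))
    (t : MvPolynomial ι K) (A : MvPolynomial ι K) :
    (Ψ[v] A).map ((Polynomial.evalRingHom t).comp (Ψ[v] : MvPolynomial ι K →ₐ[K] _).toRingHom)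
      = Polynomial.taylor t (Ψ[v] A) := by
  have hvt : ∀ j, (Ψ[v] (v j)).eval t = v j := fun j => by rw [hv, Polynomial.eval_C]
  have key : (Polynomial.mapRingHom ((Polynomial.evalRingHom t).comp
        (Ψ[v] : MvPolynomial ι K →ₐ[K] _).toRingHom)).comp (Ψ[v] : MvPolynomial ι K →ₐ[K] _).toRingHom
      = (Polynomial.compRingHom (Polynomial.X + Polynomial.C t)).comp
        (Ψ[v] : MvPolynomial ι K →ₐ[K] _).toRingHom := by
    refine MvPolynomial.ringHom_ext (fun a => ?_) (fun j => ?_)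
    · simp only [RingHom.coe_comp, AlgHom.toRingHom_eq_coe, RingHom.coe_coe, Function.comp_apply,
        Polynomial.coe_mapRingHom, Polynomial.coe_compRingHom_apply, shift_C, Polynomial.map_C,
        Polynomial.C_comp, Polynomial.coe_evalRingHom, Polynomial.eval_C]
    · simp only [RingHom.coe_comp, AlgHom.toRingHom_eq_coe, RingHom.coe_coe, Function.comp_apply,
        Polynomial.coe_mapRingHom, Polynomial.coe_compRingHom_apply, shift_X, Polynomial.map_add,
        Polynomial.map_mul, Polynomial.map_C, Polynomial.map_X, Polynomial.coe_evalRingHom, Polynomial.eval_add,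
        Polynomial.eval_C, Polynomial.eval_mul, Polynomial.eval_X, hvt, Polynomial.C_comp, Polynomial.X_comp,
        map_add, map_mul]
      ring
  have h := congrArg (fun φ : MvPolynomial ι K →+* Polynomial (MvPolynomial ι K) => φ A) key
  simpa only [RingHom.coe_comp, AlgHom.toRingHom_eq_coe, RingHom.coe_coe, Function.comp_apply,
    Polynomial.coe_mapRingHom, Polynomial.coe_compRingHom_apply, Polynomial.taylor_apply] using h

/-- (ours, bookkeeping) **`exp(T𝔇)` is a one-parameter group** (engine form of RE-DERIVATION-eng1-g42 §3.3 (c)): with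
`F := Ψ_v A = Σ_b w^b Δ^{(b)} A`, `E := ∫_0^X F` (so `[T^M] E = Δ^{(M-1)} A · ω_{M-1}`), `σ_t` the shift by `t·v` on
coefficients, `ω` fixed by `σ_t` (e.g. constants, `shiftEval_C`) with `ω_b (b+1) = 1` for `b ≤ deg F`, `v` constant along
its flow (`t`, `u` arbitrary): `E(t + u) = E(t) + (E.map σ_t)(u)` — "`E(T₁ + T₂; y) = E(T₁; y) + E(T₂; y + T₁C)`".
[cite: Lang2002, Ch. IV §1] -/
theorem eval_add_antideriv_shift (v : ι → MvPolynomial ι K) (hv : ∀ j, Ψ[v] (v j) = Polynomial.C (v j))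
    (t : MvPolynomial ι K) (A : MvPolynomial ι K) {ω : ℕ → MvPolynomial ι K}
    (hω : ∀ b ≤ (Ψ[v] A).natDegree, ω b * (b + 1 : MvPolynomial ι K) = 1)
    (hωt : ∀ b, ((Polynomial.evalRingHom t).comp (Ψ[v] : MvPolynomial ι K →ₐ[K] _).toRingHom) (ω b) = ω b)
    (u : MvPolynomial ι K) :
    (antideriv ω (Ψ[v] A)).eval (t + u)
      = (antideriv ω (Ψ[v] A)).eval t
        + ((antideriv ω (Ψ[v] A)).map
            ((Polynomial.evalRingHom t).comp (Ψ[v] : MvPolynomial ι K →ₐ[K] _).toRingHom)).eval u := by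
  have hdeg : ((Ψ[v] A).map ((Polynomial.evalRingHom t).comp
      (Ψ[v] : MvPolynomial ι K →ₐ[K] _).toRingHom)).natDegree = (Ψ[v] A).natDegree := by
    rw [map_shift_eq_taylor v hv t, Polynomial.natDegree_taylor]
  rw [map_antideriv _ ω ω hωt hdeg, map_shift_eq_taylor v hv t, eval_add_antideriv hω]

end Shift

/-! ## Smoke tests -/

section Smoke

/-- Smoke test (ours): the simplest integral `∫_0^X 1 = X` (`ω₀ · 1 = 1`). -/
example : antideriv (fun _ => (1 : ℤ)) (1 : Polynomial ℤ) = Polynomial.X := by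
  unfold antideriv
  simp

/-- Smoke test (ours): the group law for `F = 1`: `(t + u) = t + u`. -/
example (t u : ℤ) : (antideriv (fun _ => (1 : ℤ)) (1 : Polynomial ℤ)).eval (t + u)
    = (antideriv (fun _ => (1 : ℤ)) 1).eval t + (antideriv (fun _ => (1 : ℤ)) (Polynomial.taylor t 1)).eval u :=
  eval_add_antideriv (fun b hb => by simp at hb; subst hb; simp) t u

end Smoke

end FormalIntegral

end Literature.AlgebraicGeometry.Resolution.WeightedBlowup
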